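import Summits.BirchSwinnertonDyer.BirchSwinnertonDyer.Theses.EisensteinPrimes
import Summits.BirchSwinnertonDyer.BirchSwinnertonDyer.Theorems.Rank1ResidualX1Isogeny
import Summits.BirchSwinnertonDyer.Rank1Residual.X1.TamagawaSqueeze
import Literature.NumberTheory.EllipticCurves.Kato2004.DivisibilityInputs
import Literature.NumberTheory.EllipticCurves.Kato2004.EulerSystemClasses
import HarnessLib

/-!
# Sketch — crux idea `eisenstein-kolyvagin-rigidity` on `MazurMCOnX1RankZero`
(stmt-BirchSwinnertonDyer-19035; planner seat bsd-eis-idea g16).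

LEVER. At the ÉTALE end `E_ét` of an X1 rank-0 class (`E_ét[p] = (𝟙 b; 0 ω)`, non-split, Kummer class
`d = [b] ∈ ℚ^×/ℚ^{×p}`) run Mazur–Rubin's theory of `Λ`-adic KOLYVAGIN SYSTEMS for Kato's
`𝐓 = T_pE_ét ⊗ Λ` with UNIPOTENT transverse elements `τ` (inertia at a multiplicative prime `ℓ ∣ N`
with `p ∤ v_ℓ(q)`: `ρ(τ²) = (1 2n; 0 1)`, `T/(τ²-1)T ≅ ℤ_p` free of rank one — MR (H.2) holds although
(H.1) irreducibility fails).  The residual classes INVISIBLE to all such Kolyvagin primes are exactly the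
CHARACTER classes `im H¹(ℚ_Σ/ℚ_n, ℤ/p^k·𝟙) → H¹(ℚ_n, E_ét[p^k])`, a piece of `𝔽_p`-dimension
`≤ s_∞ = Σ_{ℓ∣N, ℓ≡1 (p)} g_ℓ(∞)` UNIFORMLY in the tower and `0` in the `Λ`-adic limit
(`𝐇¹_Iw(ℚ_∞, ℤ/p) = 0`); quotienting the Selmer sheaf by it, MR's rigidity (`KS(𝐓)` free of rank one;
for a generator `κ`, `char 𝐇² = char(𝐇¹/Λκ₁)` up to `p`-powers) converts the open LOWER bound
`λ_alg(E_ét) ≥ λ_an(E_ét)` into RESIDUAL PRIMITIVITY of Kato's system: `κ̄^{Kato} ≠ 0` modulo characters,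
read on the `μ_p`-QUOTIENT (Kummer / `S`-unit) coordinate of the bottom class — where Kurihara numbers
(g13) are blind.

Typed here over TREE declarations only: the posited object (`KolyvaginModuleData`, an interface over
Kato's pinned `𝐇¹ = IwasawaH1Data`; existence/fidelity is a separate statement, never a field), the crux
Props F1 `BorelRigidity`, F3 `KatoResiduallyPrimitive`, the construction Prop F2 `KolyvaginModuleExists`,
the element-level rigidity squeeze (PROVED), the support dictionary S1 `RigidityDictionary` (Kato §17.13
bookkeeping, typed), and the first lemma of the line (PROVED from the tree doors
`X1.TamagawaSqueeze.mazurMainConjecture_of_algebraicLambdaGE`, `X1.MuPart.muPartAt_of_analyticMuLE_zero`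
and the isogeny transport `mazurMainConjecture_iff_of_isIsogenous_of_analyticRank_eq_zero`).
Nothing is asserted; no `sorry`.
-/

set_option linter.dupNamespace false
set_option autoImplicit false

noncomputable section

open WeierstrassCurve Literature.NumberTheory.EllipticCurves
  Literature.NumberTheory.EllipticCurves.ModularForms
  Literature.NumberTheory.EllipticCurves.Rank1Residual
open Summit.BirchSwinnertonDyer.Rank1Residual
open Summit.BirchSwinnertonDyer.BirchSwinnertonDyer.Theorems
open Summit.BirchSwinnertonDyer.BirchSwinnertonDyer.Theorems.Rank1ResidualX1Defs
open Summit.BirchSwinnertonDyer.BirchSwinnertonDyer.Theorems.Rank1ResidualX1Isogeny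
open Summit.BirchSwinnertonDyer.Rank1Residual.X1.MuLambda

namespace Summit.BirchSwinnertonDyer.BirchSwinnertonDyer.Cruxes.MazurMCOnX1RankZero.EisensteinRigidity

/-! ## §1. The posited object: the Λ-adic Kolyvagin module over Kato's pinned `𝐇¹` -/

section Object

variable (p : ℕ) [Fact p.Prime] (W : WeierstrassCurve ℚ) [W.IsElliptic]
  [ContinuousSMul ℤ_[p] (W.tateModule p)] (κ : ZpExtension ℚ p) (γ : Field.absoluteGaloisGroup ℚ)

/-- **Λ-adic Kolyvagin module datum (INTERFACE; nothing asserted).** An abstract `Λ`-module `KS`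
(intended: Mazur–Rubin's module of `Λ`-adic Kolyvagin systems `KS(T_pW ⊗ Λ, F_Λ, P_unip)` for the
Selmer structure relaxed at `p` and the set `P_unip` of Kolyvagin primes whose Frobenius is conjugate to
a UNIPOTENT Kummer element `τ ∈ G_{ℚ(μ_{p^∞})}`, taken MODULO the character subsystems), the
bottom-class map `κ ↦ κ₁ ∈ 𝐇¹_Γ(T_pW)` (Kato's pinned Iwasawa cohomology `I.H`), and a distinguished
element `kato` (intended: the Kolyvagin system derived from Kato's zeta Euler system, Kato Thm. 12.6 /
Ex. 13.3).  Existence and FIDELITY of an instance are NOT fields: fidelity is an explicit predicate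
parameter `Φ : FidelityPredicate` of every statement below (to be DEFINED by the definition request D1 =
Mazur–Rubin's `KS` as an honest `Λ`-module of sections of the Selmer sheaf), existence is the separate
statement `KolyvaginModuleExists Φ` (F2).  Over the bare interface (`Φ := ⊤`) F1/F3 would be refutable by
junk data (`kato := 0`, or `bottom 1 := z_Kato / s`), which is exactly why `Φ` is a binder.
[cite: MazurRubin2004, Def. 3.1.3, §5.3 (Λ-adic Kolyvagin systems), Thm. 5.3.10] [cite: Kato2004Asterisque, Thm. 12.6, Ex. 13.3] -/
structure KolyvaginModuleData (I : Kato2004.IwasawaH1Data W p κ γ) where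
  /-- The module of Λ-adic Kolyvagin systems (modulo character subsystems). -/
  KS : Type
  [addCommGroup : AddCommGroup KS]
  [module : Module (IwasawaAlgebra p) KS]
  /-- `κ ↦ κ₁`: the bottom class of a Kolyvagin system, in `𝐇¹_Γ(T_pW)`. -/
  bottom : KS →ₗ[IwasawaAlgebra p] I.H
  /-- Kato's Kolyvagin system `κ^{Kato}` (its bottom class spans Kato's zeta submodule `Z ≤ 𝐇¹`; that
  clause is imposed where a §17.13 package `K` is in scope, see `IsAnchored`). -/
  kato : KS

attribute [instance] KolyvaginModuleData.addCommGroup KolyvaginModuleData.module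

variable {p W κ γ}

namespace KolyvaginModuleData

variable {I : Kato2004.IwasawaH1Data W p κ γ} (M : KolyvaginModuleData p W κ γ I)

/-- `KS` is free of rank one over `Λ` (the reducible analogue of MR Thm. 5.3.10 (ii)). [cite: MazurRubin2004, Thm. 5.3.10] -/
def FreeRankOne : Prop :=
  Module.Free (IwasawaAlgebra p) M.KS ∧ Module.finrank (IwasawaAlgebra p) M.KS = 1

/-- `k` generates `KS`. [folklore] -/
def IsGenerator (k : M.KS) : Prop :=
  Submodule.span (IwasawaAlgebra p) {k} = ⊤

/-- The COORDINATE IDEAL of Kato's system: the ideal of values `φ(κ^{Kato})` over all `Λ`-linear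
functionals `φ : KS → Λ`; for `KS = Λ·κ^{gen}` free and `κ^{Kato} = s·κ^{gen}` it is `(s)`. [folklore] -/
def coordIdeal : Ideal (IwasawaAlgebra p) :=
  Ideal.span (Set.range fun φ : M.KS →ₗ[IwasawaAlgebra p] IwasawaAlgebra p ↦ φ M.kato)

/-- The bottom index of a system `k`: `char_Λ(𝐇¹/Λ·k₁)`. [folklore] -/
def bottomIndex (k : M.KS) : Ideal (IwasawaAlgebra p) :=
  Literature.NumberTheory.EllipticCurves.Module.charIdeal (IwasawaAlgebra p)
    (I.H ⧸ Submodule.span (IwasawaAlgebra p) {M.bottom k})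

/-- `M` is ANCHORED to a §17.13 package `K`: `bottom` is injective and the bottom class of `κ^{Kato}`
spans Kato's zeta submodule `K.Z ≤ 𝐇¹` (Kato Thm. 12.6). [cite: Kato2004Asterisque, Thm. 12.6] -/
def IsAnchored {W' : WeierstrassCurve ℚ} [W'.IsElliptic] [W'.IsGloballyMinimal]
    [ContinuousSMul ℤ_[p] (W'.tateModule p)] {I' : Kato2004.IwasawaH1Data W' p κ γ}
    (M' : KolyvaginModuleData p W' κ γ I') {N : ℕ} [NeZero N] {f : CuspForm (CongruenceSubgroup.Gamma0 N) 2}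
    {D : W'.SelmerDualData κ γ} (K : Kato2004.DivisibilityInputs W' p f κ γ I' D) : Prop :=
  Function.Injective M'.bottom ∧ Submodule.span (IwasawaAlgebra p) {M'.bottom M'.kato} = K.Z

end KolyvaginModuleData

/-- **D1 placeholder — the FIDELITY predicate.** A predicate singling out, among all interface data,
Mazur–Rubin's module of `Λ`-adic Kolyvagin systems (modulo character subsystems) with its true bottom
map and Kato's true system; every statement of the line is parametrised by it, and the line's cruxes are
its instances at the predicate D1 will define. [cite: MazurRubin2004, Def. 3.1.3, Def. 3.1.6, §5.3] -/
abbrev FidelityPredicate (p : ℕ) [Fact p.Prime] (W : WeierstrassCurve ℚ) [W.IsElliptic]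
    [ContinuousSMul ℤ_[p] (W.tateModule p)] : Type 1 :=
  ∀ ⦃κ : ZpExtension ℚ p⦄ ⦃γ : Field.absoluteGaloisGroup ℚ⦄ ⦃I : Kato2004.IwasawaH1Data W p κ γ⦄,
    KolyvaginModuleData p W κ γ I → Prop

end Object

/-! ## §2. The statements of the line (TYPED; nothing asserted) -/

section Statements

variable (p : ℕ) [Fact p.Prime] (W : WeierstrassCurve ℚ) [W.IsElliptic] [W.IsGloballyMinimal]
  [ContinuousSMul ℤ_[p] (W.tateModule p)] (Φ : FidelityPredicate p W)

/-- **F2 (construction statement).** For the cyclotomic `κ`, a topological generator `γ` and every pinned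
`𝐇¹`, a Kolyvagin module datum exists and is free of rank one. (Intended content: MR §5.3 for
`T_pE_ét ⊗ Λ` with (H.1) replaced by "non-split Borel + Kummer element", modulo character subsystems.)
[cite: MazurRubin2004, §5.3] -/
def KolyvaginModuleExists : Prop :=
  ∀ (κ : ZpExtension ℚ p) (γ : Field.absoluteGaloisGroup ℚ), κ.IsCyclotomic → κ.IsTopGenerator γ →
    ∀ [NeZero (W.conductorNorm ℤ)] (f : CuspForm (CongruenceSubgroup.Gamma0 (W.conductorNorm ℤ)) 2),
      IsNewformOf W f →
    ∀ (I : Kato2004.IwasawaH1Data W p κ γ) (D : W.SelmerDualData κ γ)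
      (K : Kato2004.DivisibilityInputs W p f κ γ I D),
      ∃ M : KolyvaginModuleData p W κ γ I, Φ M ∧ M.IsAnchored K ∧ M.FreeRankOne

/-- **F1 — BOREL RIGIDITY (crux, rank 2).** For every newform `f` of `W`, every §17.13 package `K`
(`K.H2 = 𝐇²`), every free rank-one Kolyvagin module datum `M` and every GENERATOR `k` of `M.KS`:
`char_Λ 𝐇² = char_Λ(𝐇¹/Λ·k₁)` UP TO POWERS OF `p` — Mazur–Rubin rigidity (Thm. 5.3.10 (iii)) for the
residually BOREL lattice, the `p`-power slack being the price of the uniformly finite character piece.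
[cite: MazurRubin2004, Thm. 5.3.10 (iii)] [cite: CGLS2022, Thm. 3.2.1 (the reducible one-divisibility analogue over K)] -/
def BorelRigidity : Prop :=
  ∀ (κ : ZpExtension ℚ p) (γ : Field.absoluteGaloisGroup ℚ), κ.IsCyclotomic → κ.IsTopGenerator γ →
    ∀ [NeZero (W.conductorNorm ℤ)] (f : CuspForm (CongruenceSubgroup.Gamma0 (W.conductorNorm ℤ)) 2),
      IsNewformOf W f →
    ∀ (I : Kato2004.IwasawaH1Data W p κ γ) (D : W.SelmerDualData κ γ)
      (K : Kato2004.DivisibilityInputs W p f κ γ I D) (M : KolyvaginModuleData p W κ γ I),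
      Φ M → M.IsAnchored K → M.FreeRankOne → ∀ k : M.KS, M.IsGenerator k →
        ∃ a b : ℕ,
          Ideal.span {(PowerSeries.C ((p : ℤ_[p]) ^ a) : IwasawaAlgebra p)} *
              Literature.NumberTheory.EllipticCurves.Module.charIdeal (IwasawaAlgebra p) K.H2 =
            Ideal.span {(PowerSeries.C ((p : ℤ_[p]) ^ b) : IwasawaAlgebra p)} * M.bottomIndex k

/-- **F3 — KATO RESIDUAL PRIMITIVITY (crux, rank 3).** Kato's Kolyvagin system is PRIMITIVE: its
coordinate ideal in the rank-one module `KS` is the unit ideal — equivalently `κ̄^{Kato} ≠ 0` in the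
residual module, i.e. some derived class `κ̄ⁿ` is a non-zero element of `H¹(ℚ, E_ét[p])` modulo
characters, detected on the `μ_p`-quotient (Kummer / `S`-unit) coordinate.
[cite: MazurRubin2004, Def. 4.5.5, Thm. 5.3.10] [cite: Kato2004Asterisque, Thm. 12.5] -/
def KatoResiduallyPrimitive : Prop :=
  ∀ (κ : ZpExtension ℚ p) (γ : Field.absoluteGaloisGroup ℚ), κ.IsCyclotomic → κ.IsTopGenerator γ →
    ∀ [NeZero (W.conductorNorm ℤ)] (f : CuspForm (CongruenceSubgroup.Gamma0 (W.conductorNorm ℤ)) 2),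
      IsNewformOf W f →
    ∀ (I : Kato2004.IwasawaH1Data W p κ γ) (D : W.SelmerDualData κ γ)
      (K : Kato2004.DivisibilityInputs W p f κ γ I D) (M : KolyvaginModuleData p W κ γ I),
      Φ M → M.IsAnchored K → M.FreeRankOne → M.coordIdeal = ⊤

/-- **S1 — RIGIDITY DICTIONARY (support).** Kato's §17.13 bookkeeping: `char X = char(P/loc 𝐇¹)·char 𝐇²`
(pseudo-null slack from `𝐇²_loc` finite), `(p^n L_p) = char(P/loc 𝐇¹)·char(𝐇¹/Λ z)` (Coleman map with
finite cokernel), `char(𝐇¹/Λz) = coordIdeal · bottomIndex(κ^{gen})`; with F1–F3 this is the element-level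
squeeze `lam_eq_of_rigiditySqueeze` below and yields `λ_alg(W) ≥ n` whenever `λ_an(W) = n`.
[cite: Kato2004Asterisque, §17.13 (17.13.1)–(17.13.4), Prop. 17.11] -/
def RigidityDictionary : Prop :=
  KolyvaginModuleExists p W Φ → BorelRigidity p W Φ → KatoResiduallyPrimitive p W Φ →
    ∀ n : ℕ, X1.ParitySqueeze.AnalyticLambdaEq W p n → X1.TamagawaSqueeze.AlgebraicLambdaGE W p n

end Statements

/-! ## §3. The element-level rigidity squeeze (PROVED) -/

section Algebra

variable {p : ℕ} [Fact p.Prime]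

/-- `λ(p^a) = 0`. [folklore] -/
theorem lam_C_pow (a : ℕ) : lam (PowerSeries.C ((p : ℤ_[p]) ^ a) : IwasawaAlgebra p) = 0 := by
  have h1 : red (1 : IwasawaAlgebra p) ≠ 0 := by simp [red]
  obtain ⟨-, hpf⟩ := mu_eq_and_pfree_eq (a := a) (g := PowerSeries.C ((p : ℤ_[p]) ^ a)) h1
    (by rw [mul_one])
  rw [lam, hpf]
  simp [red]

/-- `λ(u) = 0` for a unit `u`. [folklore] -/
theorem lam_of_isUnit {u : IwasawaAlgebra p} (hu : IsUnit u) : lam u = 0 :=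
  ((isUnit_iff_mu_eq_zero_and_lam_eq_zero u).mp hu).2.2

/-- **The rigidity squeeze.** In `Λ`: if `X = j·q` (Poitou–Tate: `char X = char(P/loc 𝐇¹)·char 𝐇²`),
`G = j·c·s·u` (Coleman: `(p^n L_p) = char(P/loc 𝐇¹)·bottomIndex(κ^{gen})·coord(κ^{Kato})·unit`),
RIGIDITY `p^a·q = p^b·c` (F1) and PRIMITIVITY `s ∈ Λ^×` (F3), then `λ(G) = λ(X)`, i.e.
`λ_an = λ_alg`. [folklore] -/
theorem lam_eq_of_rigiditySqueeze {j q c s u X G : IwasawaAlgebra p} (hj : j ≠ 0) (hq : q ≠ 0)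
    (hc : c ≠ 0) (hs : IsUnit s) (hu : IsUnit u) (hX : X = j * q) (hG : G = j * c * s * u)
    {a b : ℕ} (hrig : PowerSeries.C ((p : ℤ_[p]) ^ a) * q = PowerSeries.C ((p : ℤ_[p]) ^ b) * c) :
    lam G = lam X := by
  have hqc : lam q = lam c := by
    have h := congrArg lam hrig
    rw [lam_mul (C_pow_ne_zero a) hq, lam_mul (C_pow_ne_zero b) hc, lam_C_pow, lam_C_pow] at h
    simpa using h
  have hjc : j * c ≠ 0 := mul_ne_zero hj hc
  have hjcs : j * c * s ≠ 0 := mul_ne_zero hjc hs.ne_zero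
  rw [hG, hX, lam_mul hjcs hu.ne_zero, lam_mul hjc hs.ne_zero, lam_mul hj hc, lam_mul hj hq,
    lam_of_isUnit hs, lam_of_isUnit hu, hqc]
  omega

end Algebra

/-! ## §4. The first lemma of the line (PROVED from the tree doors) -/

/-- **First lemma of the line.** At an X1 rank-`0` pair `(E, p)`: if SOME globally minimal member `E'`
of the class (intended: the étale end `E_ét`) carries the Eisenstein–Kolyvagin package — F2 (Kolyvagin
module, free of rank one), F1 (Borel rigidity), F3 (residual primitivity of Kato's system), the support
dictionary S1 — together with the certified analytic invariants `λ_an(E') = n`, `μ_an(E') = 0`, then,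
granted the PUBLISHED facts Wuthrich 2014 Thm. 16, Greenberg 1999 Thm. 4.1, modularity, GZK and Cassels
(the isogeny transport of the tree), Mazur's main conjecture holds at `(E, p)`. -/
def FirstLemma : Prop :=
  ∀ (W : WeierstrassCurve ℚ) [W.IsElliptic] [W.IsGloballyMinimal] (p : ℕ) [Fact p.Prime],
    ClassX1 W p → W.analyticRank = 0 →
    ∀ (W' : WeierstrassCurve ℚ) [W'.IsElliptic] [W'.IsGloballyMinimal]
      [ContinuousSMul ℤ_[p] (W'.tateModule p)], IsIsogenous W W' →
      ∀ Φ : FidelityPredicate p W',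
      KolyvaginModuleExists p W' Φ → BorelRigidity p W' Φ → KatoResiduallyPrimitive p W' Φ →
      RigidityDictionary p W' Φ →
      (∃ n : ℕ, X1.ParitySqueeze.AnalyticLambdaEq W' p n) → X1.MuPart.AnalyticMuLE W' p 0 →
      Wuthrich2014.charIdeal_dvd_padicLFunction → greenberg_charValue_rankZero →
      nonempty_modularParametrizationData → hasEntireLFunction_rat →
      rank_eq_analyticRank_of_analyticRank_le_one → bsdRHS_eq_of_isIsogenous →
      MazurMainConjecture W p

/-- **The first lemma holds in the tree**, so the idea's open content is exactly F2 ∧ F1 ∧ F3 (∧ S1). -/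
theorem firstLemma_holds : FirstLemma := by
  intro W _ _ p _ hX1 hr0 W' _ _ _ hiso Φ hF2 hF1 hF3 hS1 hlam hμan hW16 hGr hmod hmod' hGZK hCas
  obtain ⟨n, hn⟩ := hlam
  have hX1' : ClassX1 W' p := ClassX1.of_isIsogenous hiso hX1
  have hp2 : 2 < p := hX1'.1
  have hred : Red W' p := hX1'.2.1
  have hgood : Good W' p := hX1'.2.2.1
  have hp : p ≠ 2 := by omega
  obtain ⟨-, hord⟩ := goodOrd_of_red_of_good W' p hp2 hgood hred
  have hμ : X1.MuLambda.MuPartAt W' p :=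
    X1.MuPart.muPartAt_of_analyticMuLE_zero hW16 hp hgood hord hred hμan
  have halg : X1.TamagawaSqueeze.AlgebraicLambdaGE W' p n := hS1 hF2 hF1 hF3 n hn
  have hMC' : MazurMainConjecture W' p :=
    X1.TamagawaSqueeze.mazurMainConjecture_of_algebraicLambdaGE hW16 hp hgood hord hred hμ hn halg le_rfl
  exact (mazurMainConjecture_iff_of_isIsogenous_of_analyticRank_eq_zero hW16 hGr hmod hmod' hGZK hCas
    W W' hiso p hX1 hr0).mpr hMC'

end Summit.BirchSwinnertonDyer.BirchSwinnertonDyer.Cruxes.MazurMCOnX1RankZero.EisensteinRigidity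

end
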